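import Literature.Geometry.Lorentzian.BackgroundChartCalculus
import Literature.Geometry.Lorentzian.NearMinkowskiChart
import HarnessLib

/-!
# The near-Minkowski chart spacetime is late-charted and tame in its own chart

For `L : NearMinkowskiChart O` the identity `↥O → (O, G, ∂₀)` is a late chart of the Minkowski
background on `O` (`IsLateChart`, any `τ₀`), its deviation is `G − η` (`deviation_id`,
`deviationExtend_id_of_mem`), so its `Cᵏ` sup norms over subsets of `O` are those of `G − η`
(`supCkENorm_deviationExtend_id`). Consequently the limit spacetime of the local Cheeger–Gromov
compactness theorem (`TameChartCompactness.lean`), which inherits `‖G − η‖ ≤ θ` and the bounds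
`supCkENorm O k (G − η) ≤ Λ_k`, satisfies about its base point the same uniform-tameness clause as
the sources, with the same constants, in its own chart: pointed limits of uniformly tame spacetimes
are tame (Petersen 2006, Ch. 10, §3.2, the limit lies in the same class).

## References
* P. Petersen, *Riemannian Geometry*, 2nd ed., GTM 171, Springer 2006, Ch. 10, §3.2. [Petersen2006]
-/

noncomputable section

open Set Filter TopologicalSpace Function
open scoped Manifold ContDiff Topology ENNReal

namespace Literature.Geometry.Lorentzian

namespace NearMinkowskiChart

variable {O : Opens E4} (L : NearMinkowskiChart O) (hO : IsConnected (O : Set E4))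

/-- The late region of the Minkowski background on `O` is open in `↥O`. [folklore] -/
theorem _root_.Literature.Geometry.Lorentzian.Minkowski.isOpen_lateRegion_backgroundOn
    (O : Opens E4) (τ₀ : ℝ) : IsOpen ((Minkowski.backgroundOn O).lateRegion τ₀) := by
  have hc : Continuous fun x : O ↦ (x : E4) 0 :=
    (EuclideanSpace.proj (0 : Fin 4)).continuous.comp continuous_subtype_val
  exact isOpen_lt continuous_const hc

/-- **The identity is a late chart of the near-Minkowski chart spacetime** over the Minkowski
background on `O`, after any time `τ₀`, into any region containing the late region. [folklore] -/
theorem isLateChart_id (τ₀ : ℝ) :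
    (L.spacetime hO).IsLateChart (Minkowski.backgroundOn O) univ τ₀
      (id : O → (L.spacetime hO).carrier) where
  contMDiff := contMDiff_id
  isOpenEmbedding :=
    -- the restriction of the identity to the (open) late region is the inclusion of a subtype
    (Minkowski.isOpen_lateRegion_backgroundOn O τ₀).isOpenEmbedding_subtypeVal
  image_subset := subset_univ _

/-- **The deviation of the identity chart is `G − η`.** [folklore] -/
theorem deviation_id (x : O) :
    (L.spacetime hO).deviation (Minkowski.backgroundOn O) (id : O → (L.spacetime hO).carrier) x =
      L.G x - Minkowski.bilin := by
  ext v w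
  have hid : mfderiv 𝓘(ℝ, E4) (𝓡 4) (id : O → (L.spacetime hO).carrier) x =
      ContinuousLinearMap.id ℝ E4 := mfderiv_id
  show (L.spacetime hO).metric.val x
      (mfderiv 𝓘(ℝ, E4) (𝓡 4) (id : O → (L.spacetime hO).carrier) x v)
      (mfderiv 𝓘(ℝ, E4) (𝓡 4) (id : O → (L.spacetime hO).carrier) x w) - Minkowski.bilin v w =
    L.G x v w - Minkowski.bilin v w
  rw [hid]
  rfl

/-- The extended deviation of the identity chart is `G − η` on `O`. [folklore] -/
theorem deviationExtend_id_of_mem {y : E4} (hy : y ∈ (O : Set E4)) :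
    (L.spacetime hO).deviationExtend (Minkowski.backgroundOn O)
      (id : O → (L.spacetime hO).carrier) y = L.G y - Minkowski.bilin := by
  have h := (L.spacetime hO).deviationExtend_coe (Minkowski.backgroundOn O)
    (id : O → (L.spacetime hO).carrier) ⟨y, hy⟩
  exact h.trans (L.deviation_id hO ⟨y, hy⟩)

/-- The extended deviation of the identity chart and `G − η` have the same germs at points of
`O`. [folklore] -/
theorem deviationExtend_id_eventuallyEq {y : E4} (hy : y ∈ (O : Set E4)) :
    (L.spacetime hO).deviationExtend (Minkowski.backgroundOn O)
      (id : O → (L.spacetime hO).carrier) =ᶠ[𝓝 y] (L.G - fun _ ↦ Minkowski.bilin) := by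
  filter_upwards [O.2.mem_nhds hy] with z hz
  rw [L.deviationExtend_id_of_mem hO hz, Pi.sub_apply]

/-- **The `Cᵏ` sup norms of the deviation of the identity chart over subsets of `O` are those of
`G − η`.** [folklore] -/
theorem supCkENorm_deviationExtend_id {K : Set E4} (hK : K ⊆ (O : Set E4)) (k : ℕ) :
    supCkENorm K k ((L.spacetime hO).deviationExtend (Minkowski.backgroundOn O)
      (id : O → (L.spacetime hO).carrier)) = supCkENorm K k (L.G - fun _ ↦ Minkowski.bilin) :=
  supCkENorm_congr fun _ hy ↦ L.deviationExtend_id_eventuallyEq hO (hK hy)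

/-- **The near-Minkowski chart spacetime is tame in its own chart, with the constants of `G`**:
if `‖G − η‖ ≤ θ` on `O` and `supCkENorm O k (G − η) ≤ Λ`, then the identity chart is a late chart
of the Minkowski background centred at any `y₀ ∈ O` with `C⁰` deviation `≤ θ` and `Cᵏ` deviation
`≤ Λ` over `O` — the per-point clause of the uniform-tameness hypotheses of the Final State
Conjecture routes, for the limit of the local Cheeger–Gromov compactness theorem (which delivers
exactly these bounds on `G`). [cite: Petersen2006, Ch. 10 §3.2] -/
theorem tame_id {θ : ℝ} (hθ : ∀ y ∈ (O : Set E4), ‖L.G y - Minkowski.bilin‖ ≤ θ) {k : ℕ} {Λ : ℝ≥0∞}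
    (hΛ : supCkENorm (O : Set E4) k (L.G - fun _ ↦ Minkowski.bilin) ≤ Λ) (τ₀ : ℝ) (y₀ : O) :
    (L.spacetime hO).IsLateChart (Minkowski.backgroundOn O) univ τ₀
        (id : O → (L.spacetime hO).carrier) ∧
      (id : O → (L.spacetime hO).carrier) y₀ = y₀ ∧
      supCkENorm (O : Set E4) k ((L.spacetime hO).deviationExtend (Minkowski.backgroundOn O)
        (id : O → (L.spacetime hO).carrier)) ≤ Λ ∧
      ∀ y ∈ (O : Set E4), ‖(L.spacetime hO).deviationExtend (Minkowski.backgroundOn O)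
        (id : O → (L.spacetime hO).carrier) y‖ ≤ θ := by
  refine ⟨L.isLateChart_id hO τ₀, rfl, ?_, fun y hy ↦ ?_⟩
  · rw [L.supCkENorm_deviationExtend_id hO subset_rfl k]
    exact hΛ
  · rw [L.deviationExtend_id_of_mem hO hy]
    exact hθ y hy

end NearMinkowskiChart

end Literature.Geometry.Lorentzian

end
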